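import Literature.Geometry.Kaehler.ComplexTorusHilbertModularGaffneyCutoff
import Literature.Geometry.Kaehler.ComplexTorusHilbertModularCuspKernelSquareIntegrable
import HarnessLib

/-!
# Freitag, *Hilbert modular forms*, Ch. III §5 «B)»: the invariant integrands `⟨α, β⟩_h` of Green's formula on `Hⁿ/Γ` — polarisation,
# `Γ`-invariance, continuity, boundedness and integrability over a fundamental domain; supports of `dη`, `⋆η`, `δη`

[cite: Freitag1990, Ch. III §5, pp. 176–178] (held `book:freitag1990-hilbert-modular-forms`, chunks p0105–p0106, VERBATIM): «B) Each square
integrable harmonic form is closed.» (p. 176, «explained in App. III without proofs»); «"square integrable" refers to the Poincaré metric» (p. 177);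
«`∫ ω ∧ *ω̄` converges» (p. 178); Appendix II AII.8 («The integral … is especially independent of the choice of a fundamental domain»).
The proof of «B)» (Gaffney) integrates the pairings `⟨dα, β⟩_h`, `⟨α, δβ⟩_h` of `Γ`-invariant forms, one of them with compact support modulo
`Γ`, over a fundamental domain `𝓕`; this file supplies the bookkeeping: such integrands are continuous, `Γ`-INVARIANT, BOUNDED, hence
INTEGRABLE over any `𝓕` of finite invariant volume. [cite: Warner1983, 6.1 (`⟨ , ⟩` on forms)]

## What is formalised (namespace `Literature.NumberTheory.Automorphic.HilbertModular`)

* §1 **polarisation** `⟨ξ, ζ⟩_h = ¼ Σ_{m<4} i^m |ξ + i^m ζ|_h²` (`poincareInner_eq_polar`), hence **`⟨M^*α, M^*β⟩_h(z) = ⟨α, β⟩_h(Mz)`**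
  (`poincareInner_moebPullback`), `Γ`-invariance of `w ↦ ⟨α, β⟩_h(w)` for `α, β ∈ M^•_∞(ℍⁿ)^Γ` (`poincareInner_toPoint_smul`), and continuity
  (`continuous_poincareInner_toPoint`); positivity `|ξ|_h² = 0 ⟹ ξ = 0` (`eq_zero_of_poincareNormSq_eq_zero`);
* §2 **`f · η ∈ M^p_∞(ℍⁿ)^Γ`** for a `Γ`-invariant smooth scalar `f` (`fun_smul_mem_invariantForms`), `|f η|_h² = |f|² |η|_h²`;
* §3 **bounded invariant integrands**: a continuous `Γ`-invariant function on `𝔥^𝐚` vanishing off the saturation `ΓK` of a compact set is bounded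
  (`exists_forall_norm_le_of_invariant`) and integrable over every set of finite volume (`integrableOn_of_invariant`); in particular
  **`w ↦ ⟨α, β⟩_h(w)` and `w ↦ ⟨β, α⟩_h(w)` are integrable over `𝓕`** when `α` has compact support modulo `Γ` (`integrableOn_poincareInner_toPoint(')`);
* §4 **supports**: if `η` vanishes above height `T` at the cusp `κ_B`, so do `dη`, `⋆η`, `δη` (`extD_toPoint_eq_zero_of_height`,
  `poincareStar_toPoint_eq_zero_of_height`, `codiff_toPoint_eq_zero_of_height`).

Theorems only: no definitions, no named facts (net debt 0), no instances, no notation.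

## References
* [Freitag1990] E. Freitag, *Hilbert modular forms*, Springer 1990: Ch. III §5, pp. 176–178; Appendix II AII.8; Appendix III Sect. X.
* [Warner1983] F. W. Warner, *Foundations of Differentiable Manifolds and Lie Groups*, GTM 94: 6.1.
-/

set_option autoImplicit false
set_option maxSynthPendingDepth 3

noncomputable section

open scoped Matrix MatrixGroups Topology ContDiff Classical NumberField ENNReal NNReal UpperHalfPlane ComplexConjugate
open Set Filter Function MeasureTheory

namespace Literature.NumberTheory.Automorphic.HilbertModular

open _root_.NumberField _root_.NumberField.InfinitePlace _root_.Complex Module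
open Literature.Geometry.Kaehler.ComplexTorus Literature.Geometry.Kaehler.ComplexTorus.HilbertModularFamily

variable {F : Type*} [Field F] [NumberField F]

/-! ## §1 Polarisation, invariance and continuity of `⟨ , ⟩_h` -/

section Polar

variable {p : ℕ}

/-- `|ξ + cζ|_h² = |ξ|_h² + c̄⟨ξ,ζ⟩_h + c \overline{⟨ξ,ζ⟩_h} + |c|²|ζ|_h²`. [cite: Warner1983, 6.1] [cite: Freitag1990, Ch. III §5, p. 177] -/
theorem poincareNormSq_add_smul (z : Point F) (ξ ζ : Point F [⋀^Fin p]→L[ℝ] ℂ) (c : ℂ) :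
    (poincareNormSq z (ξ + c • ζ) : ℂ) = poincareNormSq z ξ + conj c * poincareInner z ξ ζ + c * conj (poincareInner z ξ ζ) +
      c * conj c * poincareNormSq z ζ := by
  rw [← poincareInner_self, poincareInner_add_left, poincareInner_add_right, poincareInner_add_right, poincareInner_smul_right,
    poincareInner_smul_left, poincareInner_smul_left, poincareInner_smul_right, ← poincareInner_conj_symm z ξ ζ, poincareInner_self,
    poincareInner_self]
  ring

/-- **Polarisation: `⟨ξ, ζ⟩_h = ¼ (|ξ+ζ|_h² + i|ξ+iζ|_h² − |ξ−ζ|_h² − i|ξ−iζ|_h²)`.** [cite: Warner1983, 6.1] [cite: Freitag1990, Ch. III §5, p. 177] -/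
theorem poincareInner_eq_polar (z : Point F) (ξ ζ : Point F [⋀^Fin p]→L[ℝ] ℂ) :
    poincareInner z ξ ζ = (1 / 4 : ℂ) * ((poincareNormSq z (ξ + (1 : ℂ) • ζ) : ℂ) + I * poincareNormSq z (ξ + I • ζ) -
      poincareNormSq z (ξ + (-1 : ℂ) • ζ) - I * poincareNormSq z (ξ + (-I) • ζ)) := by
  rw [poincareNormSq_add_smul, poincareNormSq_add_smul, poincareNormSq_add_smul, poincareNormSq_add_smul]
  simp only [map_one, map_neg, Complex.conj_I]
  ring_nf
  rw [Complex.I_sq]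
  ring

/-- **`⟨M^*α, M^*β⟩_h(z) = ⟨α, β⟩_h(Mz)`** on `ℍⁿ` (`z ↦ Mz` is an isometry of the Poincaré metric; from `|M^*η|_h(z) = |η|_h(Mz)` by polarisation).
[cite: Freitag1990, Ch. II §1 (invariance of the metric); Ch. III §5, p. 177] -/
theorem poincareInner_moebPullback (M : SL(2, F)) (α β : Form F p) {z : Point F} (hz : z ∈ halfSpace F) :
    poincareInner z (moebPullback M α z) (moebPullback M β z) = poincareInner (moeb M z) (α (moeb M z)) (β (moeb M z)) := by
  have h : ∀ c : ℂ, moebPullback M α z + c • moebPullback M β z = moebPullback M (α + c • β) z := fun c ↦ by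
    rw [moebPullback_add, moebPullback_smul, Pi.add_apply, Pi.smul_apply]
  rw [poincareInner_eq_polar, poincareInner_eq_polar, h, h, h, h, poincareNormSq_moebPullback M _ hz, poincareNormSq_moebPullback M _ hz,
    poincareNormSq_moebPullback M _ hz, poincareNormSq_moebPullback M _ hz]
  rfl

/-- **`Γ`-invariance of the pairing of invariant forms: `⟨α, β⟩_h(γw) = ⟨α, β⟩_h(w)`** for `α, β ∈ M^p_∞(ℍⁿ)^Γ`, `γ ∈ Γ`.
[cite: Freitag1990, Ch. III §5, p. 177; Appendix II AII.8] -/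
theorem poincareInner_toPoint_smul [IsTotallyReal F] {Γ : Subgroup SL(2, F)} {α β : Form F p} (hα : α ∈ invariantForms Γ p)
    (hβ : β ∈ invariantForms Γ p) {γ : SL(2, F)} (hγ : γ ∈ Γ) (w : RealPlace F → ℍ) :
    poincareInner (toPoint (γ • w)) (α (toPoint (γ • w))) (β (toPoint (γ • w))) = poincareInner (toPoint w) (α (toPoint w)) (β (toPoint w)) := by
  rw [toPoint_smul, ← poincareInner_moebPullback γ α β (toPoint_mem_halfSpace w), hα.2.1 γ hγ _ (toPoint_mem_halfSpace w),
    hβ.2.1 γ hγ _ (toPoint_mem_halfSpace w)]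

/-- **`w ↦ ⟨α, β⟩_h(w)` is continuous on `𝔥^𝐚`** for `α`, `β` continuous on `ℍⁿ`. [cite: Freitag1990, Ch. III §5, p. 177] -/
theorem continuous_poincareInner_toPoint [IsTotallyReal F] {α β : Form F p} (hα : ContinuousOn α (halfSpace F))
    (hβ : ContinuousOn β (halfSpace F)) :
    Continuous fun w : RealPlace F → ℍ ↦ poincareInner (toPoint w) (α (toPoint w)) (β (toPoint w)) := by
  have hc : ∀ c : ℂ, Continuous fun w : RealPlace F → ℍ ↦ (poincareNormSq (toPoint w) (α (toPoint w) + c • β (toPoint w)) : ℂ) := by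
    intro c
    have h1 : ContinuousOn (fun z ↦ poincareNormSq z ((α + c • β) z)) (halfSpace F) :=
      continuousOn_poincareNormSq_apply (hα.add (hβ.const_smul c))
    exact Complex.continuous_ofReal.comp (h1.comp_continuous continuous_toPoint toPoint_mem_halfSpace)
  simp_rw [poincareInner_eq_polar]
  exact continuous_const.mul ((((hc 1).add (continuous_const.mul (hc I))).sub (hc (-1))).sub (continuous_const.mul (hc (-I))))

/-- **`|ξ|_h² = 0 ⟹ ξ = 0`** at `z ∈ ℍⁿ`: in Freitag's frame `|ξ|_h² = Σ_t |ξ(frame_t)|² |c_t|_h²` with `|c_t|_h² > 0`. [cite: Freitag1990, Ch. III §5,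
p. 177 (the Poincaré metric is positive definite)] -/
theorem eq_zero_of_poincareNormSq_eq_zero [IsTotallyReal F] {z : Point F} (hz : z ∈ halfSpace F) {ξ : Point F [⋀^Fin p]→L[ℝ] ℂ}
    (h : poincareNormSq z ξ = 0) : ξ = 0 := by
  have hexp := eq_sum_apply_frameTuple_smul_coordForm hz ξ
  have hsum : poincareNormSq z ξ = ∑ t : FrameIdx F p, ‖ξ (frameTuple z t)‖ ^ 2 * poincareNormSq z (coordForm (frameSymbols t) z) := by
    conv_lhs => rw [hexp]
    rw [poincareNormSq_sum_of_pairwise z _ fun t _ t' _ htt ↦ by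
      rw [poincareInner_smul_left, poincareInner_smul_right, poincareInner_coordForm_coordForm_eq_zero htt hz, mul_zero, mul_zero]]
    exact Finset.sum_congr rfl fun t _ ↦ poincareNormSq_smul z _ _
  have hpos : ∀ t : FrameIdx F p, 0 < poincareNormSq z (coordForm (frameSymbols t) z) := fun t ↦ by
    rw [coordForm_eq_wcoordForm, poincareNormSq_wcoordForm _ (frameSymbols_injective t) hz]
    exact mul_pos (pow_pos (inv_pos.2 (prod_coordWeight_pos _ hz)) 2) (Finset.prod_pos fun j _ ↦ pow_pos (hz _) 2)
  rw [hsum] at h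
  have h0 : ∀ t : FrameIdx F p, ξ (frameTuple z t) = 0 := fun t ↦ by
    have ht := (Finset.sum_eq_zero_iff_of_nonneg fun t _ ↦ mul_nonneg (sq_nonneg _) (poincareNormSq_nonneg _ _)).1 h t (Finset.mem_univ t)
    rcases mul_eq_zero.1 ht with h1 | h1
    · exact norm_eq_zero.1 (pow_eq_zero_iff two_ne_zero |>.1 h1)
    · exact absurd h1 (hpos t).ne'
  rw [hexp]
  exact Finset.sum_eq_zero fun t _ ↦ by rw [h0 t, zero_smul]

end Polar

/-! ## §2 `f · η` for an invariant scalar `f` -/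

section Smul

variable {p : ℕ} {Γ : Subgroup SL(2, F)}

/-- **`f · η ∈ M^p_∞(ℍⁿ)^Γ`** for `f` smooth on `ℍⁿ` with `f(γz) = f(z)` (`γ ∈ Γ`) and `η ∈ M^p_∞(ℍⁿ)^Γ`. [cite: Freitag1990, Ch. III §5
Remark 5.5₃, p. 180 («`α_k := φ_k · α`»); Ch. III §2, p. 142] -/
theorem fun_smul_mem_invariantForms {f : Point F → ℂ} {η : Form F p} (hf : ContDiffOn ℝ ∞ f (halfSpace F))
    (hfi : ∀ γ ∈ Γ, ∀ z ∈ halfSpace F, f (moeb γ z) = f z) (hη : η ∈ invariantForms Γ p) :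
    (fun z ↦ f z • η z) ∈ invariantForms Γ p := by
  refine mem_invariantForms_iff.2 ⟨hf.smul hη.1, fun γ hγ z hz ↦ ?_, fun z hz ↦ ?_⟩
  · have h1 := hη.2.1 γ hγ z hz
    rw [moebPullback_def] at h1 ⊢
    ext v
    simp only [ContinuousAlternatingMap.compContinuousLinearMap_apply, ContinuousAlternatingMap.smul_apply, hfi γ hγ z hz]
    rw [← ContinuousAlternatingMap.compContinuousLinearMap_apply, h1]
  · show f z • η z = 0
    rw [hη.2.2 z hz, smul_zero]

/-- `|f η|_h² = |f|² |η|_h²`. [cite: Freitag1990, Ch. III §5, p. 177] -/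
theorem poincareNormSq_fun_smul_apply (f : Point F → ℂ) (η : Form F p) (z w : Point F) :
    poincareNormSq w ((fun z ↦ f z • η z) z) = ‖f z‖ ^ 2 * poincareNormSq w (η z) :=
  poincareNormSq_smul w (f z) (η z)

end Smul

/-! ## §3 Bounded invariant integrands over a fundamental domain -/

section Bounded

variable [IsTotallyReal F] {Γ : Subgroup SL(2, F)} {E : Type*} [NormedAddCommGroup E]

omit [NumberField F] [IsTotallyReal F] in
/-- **A continuous `Γ`-invariant function on `𝔥^𝐚` vanishing off the saturation `ΓK` of a compact set is bounded** (by its maximum on `K`).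
[cite: Freitag1990, Ch. III §5, p. 181 («compact support»); Ch. I §2 Proposition 2.11] -/
theorem exists_forall_norm_le_of_invariant {g : (RealPlace F → ℍ) → E} (hg : Continuous g) (hgi : ∀ γ ∈ Γ, ∀ w, g (γ • w) = g w)
    {K : Set (RealPlace F → ℍ)} (hK : IsCompact K) (h0 : ∀ w : RealPlace F → ℍ, (∀ γ ∈ Γ, γ • w ∉ K) → g w = 0) :
    ∃ M : ℝ, ∀ w, ‖g w‖ ≤ M := by
  obtain ⟨M, hM⟩ := hK.exists_bound_of_continuousOn hg.continuousOn
  refine ⟨max M 0, fun w ↦ ?_⟩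
  by_cases h : ∃ γ ∈ Γ, γ • w ∈ K
  · obtain ⟨γ, hγ, hK'⟩ := h
    rw [← hgi γ hγ w]
    exact (hM _ hK').trans (le_max_left _ _)
  · push Not at h
    rw [h0 w h, norm_zero]
    exact le_max_right _ _

omit [IsTotallyReal F] in
/-- **… hence integrable over every set of finite invariant volume.** [cite: Freitag1990, Appendix II AII.8; Ch. III §5, p. 181] -/
theorem integrableOn_of_invariant [NormedSpace ℝ E] {g : (RealPlace F → ℍ) → E} (hg : Continuous g) (hgi : ∀ γ ∈ Γ, ∀ w, g (γ • w) = g w)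
    {K : Set (RealPlace F → ℍ)} (hK : IsCompact K) (h0 : ∀ w : RealPlace F → ℍ, (∀ γ ∈ Γ, γ • w ∉ K) → g w = 0)
    {𝓕 : Set (RealPlace F → ℍ)} (h𝓕 : volume 𝓕 < ⊤) : IntegrableOn g 𝓕 volume := by
  obtain ⟨M, hM⟩ := exists_forall_norm_le_of_invariant hg hgi hK h0
  exact Measure.integrableOn_of_bounded h𝓕.ne hg.aestronglyMeasurable (M := M) (Eventually.of_forall hM)

variable {p : ℕ}

/-- **`w ↦ ⟨α, β⟩_h(w)` is integrable over `𝓕`** for `α, β ∈ M^p_∞(ℍⁿ)^Γ` with `α` supported in the saturation of a compact set and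
`vol(𝓕) < ∞`. [cite: Freitag1990, Ch. III §5, pp. 177, 181; Appendix II AII.8] [cite: Warner1983, 6.1–6.2] -/
theorem integrableOn_poincareInner_toPoint {α β : Form F p} (hα : α ∈ invariantForms Γ p) (hβ : β ∈ invariantForms Γ p)
    {K : Set (RealPlace F → ℍ)} (hK : IsCompact K) (hK0 : ∀ w : RealPlace F → ℍ, (∀ γ ∈ Γ, γ • w ∉ K) → α (toPoint w) = 0)
    {𝓕 : Set (RealPlace F → ℍ)} (h𝓕 : volume 𝓕 < ⊤) :
    IntegrableOn (fun w ↦ poincareInner (toPoint w) (α (toPoint w)) (β (toPoint w))) 𝓕 volume :=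
  integrableOn_of_invariant (continuous_poincareInner_toPoint hα.1.continuousOn hβ.1.continuousOn)
    (fun γ hγ w ↦ poincareInner_toPoint_smul hα hβ hγ w) hK (fun w hw ↦ by rw [hK0 w hw, poincareInner_zero_left]) h𝓕

/-- The same with the compactly supported form on the right. [cite: Freitag1990, Ch. III §5, pp. 177, 181] [cite: Warner1983, 6.1–6.2] -/
theorem integrableOn_poincareInner_toPoint' {α β : Form F p} (hα : α ∈ invariantForms Γ p) (hβ : β ∈ invariantForms Γ p)
    {K : Set (RealPlace F → ℍ)} (hK : IsCompact K) (hK0 : ∀ w : RealPlace F → ℍ, (∀ γ ∈ Γ, γ • w ∉ K) → β (toPoint w) = 0)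
    {𝓕 : Set (RealPlace F → ℍ)} (h𝓕 : volume 𝓕 < ⊤) :
    IntegrableOn (fun w ↦ poincareInner (toPoint w) (α (toPoint w)) (β (toPoint w))) 𝓕 volume :=
  integrableOn_of_invariant (continuous_poincareInner_toPoint hα.1.continuousOn hβ.1.continuousOn)
    (fun γ hγ w ↦ poincareInner_toPoint_smul hα hβ hγ w) hK (fun w hw ↦ by rw [hK0 w hw, poincareInner_zero_right]) h𝓕

omit [IsTotallyReal F] in
/-- **`w ↦ |η|_h²(w)` is continuous on `𝔥^𝐚`** for `η` continuous on `ℍⁿ`. [cite: Freitag1990, Ch. III §5, p. 177] -/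
theorem continuous_poincareNormSq_toPoint {η : Form F p} (hη : ContinuousOn η (halfSpace F)) :
    Continuous fun w : RealPlace F → ℍ ↦ poincareNormSq (toPoint w) (η (toPoint w)) :=
  (continuousOn_poincareNormSq_apply hη).comp_continuous continuous_toPoint toPoint_mem_halfSpace

omit [IsTotallyReal F] in
/-- `|η|_h²(γw) = |η|_h²(w)` for `η ∈ M^p_∞(ℍⁿ)^Γ`, `γ ∈ Γ`. [cite: Freitag1990, Ch. III §5, p. 177; Appendix II AII.8] -/
theorem poincareNormSq_toPoint_smul {η : Form F p} (hη : η ∈ invariantForms Γ p) {γ : SL(2, F)} (hγ : γ ∈ Γ) (w : RealPlace F → ℍ) :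
    poincareNormSq (toPoint (γ • w)) (η (toPoint (γ • w))) = poincareNormSq (toPoint w) (η (toPoint w)) := by
  rw [toPoint_smul, ← poincareNormSq_moebPullback γ η (toPoint_mem_halfSpace w), hη.2.1 γ hγ _ (toPoint_mem_halfSpace w)]

end Bounded

/-! ## §4 Supports of `dη`, `⋆η`, `δη` high in a cusp -/

section Support

variable {p m : ℕ} {B : SL(2, F)} {T : ℝ}

/-- **If `η` vanishes above height `T` at `κ_B`, so does `dη`** (it vanishes on an open set). [cite: Freitag1990, Ch. III §5 Remark 5.5₃, p. 180] -/
theorem extD_toPoint_eq_zero_of_height (η : Form F p) (h : ∀ w : RealPlace F → ℍ, T < normIm (B • w) → η (toPoint w) = 0)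
    {w : RealPlace F → ℍ} (hw : T < normIm (B • w)) : extD η (toPoint w) = 0 := by
  have hopen : IsOpen {w' : RealPlace F → ℍ | T < normIm (B • w')} := isOpen_lt continuous_const (continuous_normIm.comp (continuous_sl_smul B))
  have hev : η =ᶠ[𝓝 (toPoint w)] fun _ ↦ (0 : Point F [⋀^Fin p]→L[ℝ] ℂ) := by
    filter_upwards [image_toPoint_mem_nhds (hopen.mem_nhds hw)]
    rintro _ ⟨w', hw', rfl⟩
    exact h w' hw'
  rw [extD_of_mem _ (toPoint_mem_halfSpace w), hev.extDeriv_eq, extDeriv_const]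

/-- **If `η` vanishes above height `T` at `κ_B`, so does `⋆η`.** [cite: Freitag1990, Appendix III Sect. X; Ch. III §5, p. 180] -/
theorem poincareStar_toPoint_eq_zero_of_height (hpm : p + m = 2 * Fintype.card (F →+* ℝ)) (η : Form F p)
    (h : ∀ w : RealPlace F → ℍ, T < normIm (B • w) → η (toPoint w) = 0) {w : RealPlace F → ℍ} (hw : T < normIm (B • w)) :
    poincareStar hpm η (toPoint w) = 0 := by
  rw [poincareStar_of_mem hpm _ (toPoint_mem_halfSpace w), h w hw, poincareStarAt_zero]

/-- **If `η` vanishes above height `T` at `κ_B`, so does `δη`.** [cite: Freitag1990, Appendix III Sect. X («`δ := ± ∗d∗`»); Ch. III §5, p. 180] -/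
theorem codiff_toPoint_eq_zero_of_height (η : Form F (p + 1)) (h : ∀ w : RealPlace F → ℍ, T < normIm (B • w) → η (toPoint w) = 0)
    {w : RealPlace F → ℍ} (hw : T < normIm (B • w)) : codiff η (toPoint w) = 0 := by
  by_cases hk : p + 1 ≤ 2 * Fintype.card (F →+* ℝ)
  · have hpm : p + 1 + (2 * Fintype.card (F →+* ℝ) - (p + 1)) = 2 * Fintype.card (F →+* ℝ) := by omega
    rw [codiff_eq hpm η, Pi.neg_apply, poincareStar_of_mem _ _ (toPoint_mem_halfSpace w),
      extD_toPoint_eq_zero_of_height _ (fun w' hw' ↦ poincareStar_toPoint_eq_zero_of_height hpm η h hw') hw, poincareStarAt_zero, neg_zero]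
  · rw [codiff_of_lt (not_le.1 hk)]
    rfl

end Support

end Literature.NumberTheory.Automorphic.HilbertModular
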